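import Summits.CriticalPhenomena.Statement
import Literature.MathematicalPhysics.QuantumFieldTheory.CFTAxioms
import Mathlib

/-!
# CriticalPhenomena / IsingCFTData — assembly

Route `CriticalPhenomena/IsingCFTData`, item `stmt-CriticalPhenomena-0664` (assembly
`X_I2 = (CFT) ∧ (ND) → Ising3DConformalLimit`). The honest glue: `CritIsing3DIsCFT` gives, via the
Literature lemma `CritIsing3DIsCFT.exists_isMoebiusCovariant`, a renormalisation `ρ`, a dimension
`Δ ∈ [1/2, 3)` (so `Δ > 0`) and a Möbius-covariant pointwise scaling limit `S`; `(ND)` applied to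
`(ρ, S)` supplies non-degeneracy and `U₄ ≢ 0`. NB: `(ND)` as typed is FALSE
(`Theorems/IsingCFTData/Refutations.lean`, `not_IsingCFTData_ND`), so the antecedent `X_I2` is
refuted and this implication, though proved by the intended argument, is currently vacuous; it
becomes contentful once the planner re-types `(ND)` with non-degeneracy as a hypothesis.
-/

namespace CriticalPhenomena.IsingCFTData

open Literature.Probability.LatticeModels Literature.Probability.Percolation

/-- Settles `stmt-CriticalPhenomena-0664` (exact signature): `(CFT) ∧ (ND) → Ising3DConformalLimit`,
by `CritIsing3DIsCFT.exists_isMoebiusCovariant` and `(ND)` at the CFT limit. [folklore] -/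
theorem conformalLimit_of_isCFT_and_ND :
    (Literature.MathematicalPhysics.QuantumFieldTheory.CritIsing3DIsCFT ∧ (∀ (ρ : ℝ → ℝ) (S : Literature.Probability.LatticeModels.CorrFamily 3), (∀ δ ∈ Set.Ioc (0:ℝ) 1, 0 < ρ δ) → Literature.Probability.LatticeModels.HasPointwiseScalingLimit (Literature.Probability.LatticeModels.criticalCorr 3) ρ S → Literature.Probability.LatticeModels.IsNondegenerateTwoPoint S ∧ Literature.Probability.LatticeModels.HasNontrivialU4 S)) → Ising3DConformalLimit := by
  rintro ⟨hCFT, hND⟩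
  obtain ⟨ρ, Δ, S, hρ, hΔ, hlim, hM⟩ := hCFT.exists_isMoebiusCovariant
  obtain ⟨hnd, hU4⟩ := hND ρ S hρ hlim
  exact ⟨ρ, Δ, S, hρ, by linarith [hΔ.1], hlim, hnd, hM, hU4⟩

/-! ### Assembly v2 (pivot after `not_IsingCFTData_thesis`)

`stmt-CriticalPhenomena-0721`: in unitary CFT data every scalar primary has a non-degenerate
two-point function (two-point normalisation `‖x-y‖^{-2Δ} > 0`).
`stmt-CriticalPhenomena-0720`: `X_I2' = CritIsing3DIsCFT ∧ (ND') → Ising3DConformalLimit`, where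
`(ND')` asks `U₄ ≢ 0` only of NON-DEGENERATE pointwise scaling limits (= `stmt-0636`); the CFT
limit's non-degeneracy now comes from the CFT side, so the route's residual content is exactly
`CritIsing3DIsCFT` (open) and `stmt-CriticalPhenomena-0636` (open). -/

/-- Settles `stmt-CriticalPhenomena-0721` (exact signature): a scalar primary of unitary CFT data
has `0 < ⟨𝒪(x₀)𝒪(x₁)⟩ = ‖x₀ - x₁‖^{-2Δ}` at every non-coincident pair.
(Poland–Rychkov–Vichi 2019 §II.D eq. (30).) [folklore] -/
theorem isNondegenerateTwoPoint_of_isUnitaryCFTData :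
    ∀ (d : ℕ) (D : Literature.Probability.LatticeModels.CFTData d), Literature.Probability.LatticeModels.IsUnitaryCFTData D → ∀ i : D.ι, D.spin i = 0 → Literature.Probability.LatticeModels.IsNondegenerateTwoPoint (D.corr i) := by
  intro d D hD i hi x hx
  have hne : x 0 ≠ x 1 := fun h => by
    have := hx h
    exact absurd this (by decide)
  have hxeq : x = ![x 0, x 1] := by
    funext j; fin_cases j <;> rfl
  rw [hxeq, hD.twoPointNormalised i hi (x 0) (x 1) hne]
  exact Real.rpow_pos_of_pos (norm_pos_iff.mpr (sub_ne_zero.mpr hne)) _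

/-- Settles `stmt-CriticalPhenomena-0720` (exact signature): assembly v2,
`CritIsing3DIsCFT ∧ (ND') → Ising3DConformalLimit`. [folklore] -/
theorem conformalLimit_of_isCFT_and_ND' :
    (Literature.MathematicalPhysics.QuantumFieldTheory.CritIsing3DIsCFT ∧ (∀ (ρ : ℝ → ℝ) (S : Literature.Probability.LatticeModels.CorrFamily 3), (∀ δ ∈ Set.Ioc (0:ℝ) 1, 0 < ρ δ) → Literature.Probability.LatticeModels.HasPointwiseScalingLimit (Literature.Probability.LatticeModels.criticalCorr 3) ρ S → Literature.Probability.LatticeModels.IsNondegenerateTwoPoint S → Literature.Probability.LatticeModels.HasNontrivialU4 S)) → Ising3DConformalLimit := by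
  rintro ⟨⟨ρ, B, D, h, hρ, -, hlim⟩, hND⟩
  have hnd : IsNondegenerateTwoPoint (D.corr h.sigmaField) :=
    isNondegenerateTwoPoint_of_isUnitaryCFTData 3 D h.isUnitaryCFTData h.sigmaField
      h.sigmaField_spec.1
  refine ⟨ρ, h.deltaSigma, D.corr h.sigmaField, hρ, by linarith [h.deltaSigma_mem_Ico.1], hlim,
    hnd, h.isUnitaryCFTData.isCovariant h.sigmaField h.sigmaField_spec.1, ?_⟩
  exact hND ρ _ hρ hlim hnd

end CriticalPhenomena.IsingCFTData
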